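import Summits.HodgeConjecture.HodgeConjecture.Theses.RigidRelativesJacobianTorelli
import Literature.AlgebraicGeometry.HodgeTheory.MotivatedClasses

/-!
# Birth skeleton (BC3) of the crux `HodgeIsoForcesRelatives` (stmt-HodgeConjecture-18579),
# route `RigidRelativesJacobianTorelli` — line `birth`: "a Hodge isomorphism of rigid-type
# threefolds is MOTIVATED, and motivated correspondences over `ℚ` are Galois-compatible on an
# open subgroup" (Deligne's chain `Hodge ⇒ absolute Hodge ⇒ Galois`, cut at André's joint)

The crux (rank 3, the route's kill switch, "PERIOD SEPARATION / Hodge ≤ Galois, iso face"): for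
rigid-type threefolds `X₀, X₀'` over `ℚ` (smooth projective of dimension 3, `dim_ℂ H³((X₀)_ℂ) = 2`,
a non-zero class of Hodge type `(3,0)`), a NON-ZERO `ℂ`-linear map `Φ : H³((X₀)_ℂ) → H³((X₀')_ℂ)`
preserving rational classes and Hodge types forces the rational `ℓ`-adic `H³` of `X₀`, `X₀'` to be
isomorphic as representations of an open subgroup of `Gal(ℚ̄/ℚ)` ("relatives": the attached weight-4
newforms agree up to twist). It is a consequence of the Hodge conjecture (Deligne's chain) and is
USED by the route's `closes`; this file cuts it into three registered stubs along the one joint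
where the literature has an UNCONDITIONAL second half — André's motivated cycles:

  `Φ ≠ 0` Hodge hom of rigid-type `H³`'s
    ⟹ (STUB 1, linear algebra of rank-2 Hodge structures — provable) `Φ` is BIJECTIVE: `H³((X₀)_ℂ; ℚ)`
      is an irreducible `ℚ`-Hodge structure (`h^{3,0} = h^{0,3} = 1`, Hodge symmetry: no rank-1
      sub-Hodge structure), so the `ℚ`-descended `Φ_ℚ` is injective between rank-2 spaces;
    ⟹ (STUB 2, THE OPEN HEART — "Hodge ⇒ motivated" on the rigid `H³ ⊗ H³` sector) `Φ = γ^*` for a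
      MOTIVATED class `γ ∈ A_mot³((X₀' × X₀)_ℂ)_ℂ` (`IsMotivatedCorrespondence`, André 1996 Déf. 1 /
      §2.1 `C_mot`, on the tree's real carriers `motivatedClasses`); implied by the route target
      `RigidSectorHodge` (algebraic ⇒ motivated, André §2.1 "A_mot(X) contient A(X)") hence by HC,
      and equivalent to it under the standard conjecture `B` (André §0.3);
    ⟹ (STUB 3, IN PRINT, XL on the tree — André 1996 §2.5 a) Scolie + Prop. 2.5.1, Deligne 1982
      Prop. 2.9) a bijective motivated correspondence preserving rational classes between `H³`'s of
      smooth projective threefolds over `ℚ` is `Gal(ℚ̄/K)`-equivariant on the `ℓ`-adic realisations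
      for a number field `K`, i.e. `GalIso X₀ X₀'`: `A_mot((X₀'×X₀)_ℂ) = A_mot((X₀'×X₀)_ℚ̄)` and
      `Gal(ℚ̄/ℚ)` acts on it through a FINITE quotient (Scolie, p. 17), the `ℓ`-adic cycle class is
      equivariant, and Artin's comparison `H³_B ⊗ ℚ_ℓ ≅ H³_ét` (SGA 4 XI) carries `Φ_ℚ ⊗ ℚ_ℓ` to the
      required `U`-equivariant isomorphism `e`.

Why this cut and not "Hodge ⇒ absolute Hodge ⇒ Galois" verbatim: the tree's absolute-Hodge notion
(`HodgeTheory/AbsoluteHodgeClasses`: `IsAbsoluteHodgeClass`, de Rham conjugates `IsConjugateClass`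
only) has no `ℓ`-adic component, and Deligne's Prop. 2.9(b) needs the `ℓ`-adic components — with the
de Rham-only notion "absolute Hodge ⇒ `ℓ`-adic Galois iso" is NOT a theorem in print; André's
motivated classes are defined on the tree's real carriers (`motivatedClasses`, file
`HodgeTheory/MotivatedClasses`, imported by the route) and for them BOTH "⇒ absolute Hodge"
(Prop. 2.5.1) and "Galois acts through a finite quotient" (Scolie 2.5) are in print. Cutting at
`IsAlgebraicCorrespondence` instead would make STUB 2 verbatim the route TARGET `RigidSectorHodge`
(stmt-18577) — a costume; the motivated cut is the weakest typed joint with an unconditional tail.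

Disproof used: none on file for this crux (`ledger crux ls stmt-HodgeConjecture-18579`: no
`Disproof.lean`, no `Negative/` lemma; `ledger negatives --problem HodgeConjecture` has no statement
about rigid-type `H³`). Barriers (`Literature/Barriers/HodgeConjecture/*`): `ConjugateVarieties`
(Serre 1964 / Charles 2009) — outside: no stub transports a rational class along an automorphism of
`ℂ`; STUB 3 uses the algebraically defined `Gal(ℚ̄/ℚ)`-actions on `A_mot((X₀'×X₀)_ℚ̄)` and on
`H³_ét` of the geometric fibre (open-subgroup formulation). `AbsoluteHodgeClasses`,
`MotivatedClassesAbelianVarieties` — refutation-side no-gos on abelian varieties; they are why STUB 2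
holds in the abelian-motivic sub-case and restrict nothing here. `NormalFunctions`,
`GriffithsGroupInfiniteRank` — outside: `J²(X) = E_X` enters only as a Hodge-theoretic invariant.
The transcendence obstruction recorded on the crux ("no transcendence theory touches weight-3
periods") is exactly what makes STUB 2 open — the line does not evade it, it isolates it.

BC3 probes (this session, files `bc/probe_stub{1,2,3}.lean`: each stub signature ALONE — helper
notions re-declared, no sorried theorem in scope — against the crux and against
`_root_.HodgeConjecture`, batteries `exact?` / `simpa [notions]` / `aesop` plus the pointed residual
goals `GalIso X₀ X₀'` and `HodgeConjectureFor n X` with the stub in context, `maxHeartbeats 400000`):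
30/30 `example`s FAIL (`exact?` could not close the goal / assumption failed / aesop: failed after
exhaustive search) — table in the line card `Lines/birth.md`.
-/

noncomputable section

namespace Summit.HodgeConjecture.HodgeConjecture.Cruxes.HodgeIsoForcesRelatives.Birth

open CategoryTheory AlgebraicGeometry MonoidalCategory
open Literature.AlgebraicTopology.SingularHomology
open Literature.AlgebraicGeometry.Motives Literature.AlgebraicGeometry.HodgeTheory
open Summit.HodgeConjecture.HodgeConjecture.Theses.RigidRelativesJacobianTorelli (HodgeIsoForcesRelatives)

/-! ### The crux's `let`-bound notions, as declarations (VERBATIM the route's) -/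

/-- `X₀ ↦ (X₀)_ℂ`, the base change `ℚ ⊂ ℂ` (the crux's `cx`). [folklore] -/
abbrev cx (Y₀ : SchemeOver.{0} ℚ) : SchemeOver.{0} ℂ := (baseChange ℚ ℂ).obj Y₀

/-- RIGID TYPE (the crux's `Rigid`): `X₀` smooth projective of dimension 3 over `ℚ` with
`dim_ℂ H³((X₀)_ℂ; ℂ) = 2` and a non-zero class of Hodge type `(3,0)` (so `h^{3,0} = h^{0,3} = 1`,
`h^{2,1} = h^{1,2} = 0`: the `H³` of a rigid Calabi–Yau threefold, Gouvêa–Yui).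
[cite: GouveaYui2011, §1] -/
def Rigid (Y₀ : SchemeOver.{0} ℚ) : Prop :=
  IsSmoothProjective 3 Y₀ ∧ Module.finrank ℂ (complexBetti (cx Y₀) 3) = 2 ∧
    ∃ x : complexBetti (cx Y₀) 3, x ≠ 0 ∧ IsOfHodgeType 3 (cx Y₀) 3 3 0 x

/-- HODGE HOMOMORPHISM on `H³` (the crux's `HodgeHom`, stated for complex threefolds `Y`, `Y'`): a
`ℂ`-linear `Ψ : H³(Y(ℂ); ℂ) → H³(Y'(ℂ); ℂ)` mapping rational classes to rational classes and classes
of Hodge type `(p,q)` to classes of type `(p,q)` — the complexification of a morphism of rational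
Hodge structures `H³(Y(ℂ); ℚ) → H³(Y'(ℂ); ℚ)`. [cite: VoisinHodgeI2002, §7.1.1] -/
def IsHodgeHom (Y Y' : SchemeOver.{0} ℂ) (Ψ : complexBetti Y 3 →ₗ[ℂ] complexBetti Y' 3) : Prop :=
  (∀ x, IsRationalClass x → IsRationalClass (Ψ x)) ∧
    ∀ (p q : ℕ) (x : complexBetti Y 3), IsOfHodgeType 3 Y 3 p q x → IsOfHodgeType 3 Y' 3 p q (Ψ x)

/-- RELATIVES (the crux's `GalIso`): for some prime `ℓ` and some open subgroup `U ≤ Gal(ℚ̄/ℚ)`, the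
rational `ℓ`-adic `H³`'s of the geometric fibres are isomorphic as `U`-representations.
[cite: Faltings1983Endlichkeit, Satz 4 (semisimplicity context)] -/
def GalIso (Y₀ Y₀' : SchemeOver.{0} ℚ) : Prop :=
  ∃ (ℓ : ℕ) (_ : Fact ℓ.Prime) (U : OpenSubgroup (Field.absoluteGaloisGroup ℚ))
    (e : ellAdicEtaleCohomologyRat ℓ 3 (geometricFibre ℚ Y₀) ≃ₗ[ℚ_[ℓ]]
      ellAdicEtaleCohomologyRat ℓ 3 (geometricFibre ℚ Y₀')),
    ∀ g ∈ U, e.toLinearMap ∘ₗ geometricEllAdicEtaleCohomologyRepRat ℓ Y₀ 3 g =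
      geometricEllAdicEtaleCohomologyRepRat ℓ Y₀' 3 g ∘ₗ e.toLinearMap

/-- The crux unfolds, definitionally, to the statement over the four notions above. [folklore] -/
theorem hodgeIsoForcesRelatives_iff :
    HodgeIsoForcesRelatives ↔
      ∀ ⦃X₀ X₀' : SchemeOver.{0} ℚ⦄, Rigid X₀ → Rigid X₀' →
        ∀ Φ : complexBetti (cx X₀) 3 →ₗ[ℂ] complexBetti (cx X₀') 3,
          IsHodgeHom (cx X₀) (cx X₀') Φ → Φ ≠ 0 → GalIso X₀ X₀' :=
  Iff.rfl

/-! ### The new notion of the line: motivated correspondences (André's `C_mot(X, W)`) -/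

/-- A linear map `T : Hᵃ(X(ℂ); ℂ) → Hᵇ(W(ℂ); ℂ)` (`dim W = m`, `dim X = n`) **is induced by a
MOTIVATED correspondence** (André 1996 §2.1: "correspondances motivées" `C_mot(X, W)` = motivated
classes on the product acting as correspondences; §4.1): VERBATIM the tree's
`IsAlgebraicCorrespondence m n W X T` (`HodgeTheory/MotivatedClasses`) with the algebraic classes
`algebraicClasses (W ⊗ X) e` replaced by André's motivated classes `motivatedClasses (m + n) (W ⊗ X) e`
(the `ℂ`-span of the `pr_*(α ∪ ⋆_L β)`, Déf. 1, on the real carriers) — for some `ℂ`-orientations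
`μ` of `(W ⊗ X)(ℂ)`, `ν` of `W(ℂ)` with Poincaré duality and some motivated
`γ ∈ A_motᵉ((W ⊗ X)(ℂ))_ℂ`, `T = γ^* = pr_{W*}(pr_X^*(·) ∪ γ)` (`corrClassAction`). Since
`A(W × X) ⊆ A_mot(W × X)` (André §2.1, "Il est clair que `A_mot(X)_E` contient `A(X)`"), every
algebraic correspondence is motivated; under the standard conjecture `B` the two notions coincide
(§0.3). [cite: Andre1996Motifs, §2.1 Déf. 1 and remark following it (p. 14); §4.1] -/
def IsMotivatedCorrespondence (m n : ℕ) (W X : SchemeOver.{0} ℂ) {a b : ℕ}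
    (T : complexBetti X a →ₗ[ℂ] complexBetti W b) : Prop :=
  ∃ (μ : HomologicalOrientation ℂ (ComplexPoints (W ⊗ X)) (2 * (m + n)))
    (ν : HomologicalOrientation ℂ (ComplexPoints W) (2 * m))
    (_ : μ.HasPoincareDuality) (_ : ν.HasPoincareDuality) (e q : ℕ) (hab : a + 2 * e = b + 2 * n)
    (hq : b + q = 2 * m) (γ : complexBetti (W ⊗ X) (2 * e)),
    γ ∈ motivatedClasses (m + n) (W ⊗ X) e ∧ corrClassAction μ ν hab hq γ = T

/-! ### The three registered stubs -/

/-- STUB 1 (LINEAR ALGEBRA OF RANK-2 HODGE STRUCTURES; provable, M in print / L on the tree) —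
**a non-zero Hodge homomorphism between the `H³`'s of rigid-type threefolds is bijective.**
Why true: `V = H³((X₀)_ℂ; ℚ)` is a rational Hodge structure with `V ⊗ ℂ = V^{3,0} ⊕ V^{0,3}`,
`dim V^{3,0} = dim V^{0,3} = 1` (rank 2, a non-zero `(3,0)`-class, Hodge symmetry
`V^{0,3} = conj V^{3,0}`); a sub-Hodge structure `W ⊊ V`, `W ≠ 0`, would have `W ⊗ ℂ` of dimension 1,
conjugation-stable and equal to `W^{3,0} ⊕ W^{0,3}` — impossible, so `V` is IRREDUCIBLE; `Φ` maps
rational classes to rational classes and respects types, so it descends to a morphism of Hodge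
structures `Φ_ℚ : V → V'` with `Φ = Φ_ℚ ⊗ ℂ` (rational classes span `H³(–; ℂ)`, universal
coefficients), `ker Φ_ℚ` is a sub-Hodge structure, hence `0` (as `Φ ≠ 0`), and an injective map
between rank-2 spaces is bijective. Why it might fail / cost on the tree: only through the carriers —
it needs (i) `H³(X(ℂ); ℚ) ⊗_ℚ ℂ ≅ H³(X(ℂ); ℂ)` for the tree's `IsRationalClass` (universal
coefficients for the compact manifold `X(ℂ)`), (ii) Hodge symmetry and the independence of
`IsOfHodgeType` from the chosen `HodgeModel`, none of which is a landed theorem. Size: M (L with the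
carrier lemmas). Leans on: `IsRationalClass`, `IsOfHodgeType`, `HodgeModel.isInternal_hodgePQ`
(RationalHodgeClasses); Mathlib `LinearMap.injective_iff_surjective_of_finrank_eq_finrank`.
[cite: VoisinHodgeI2002, §7.1.1 and Lemma 7.24 (morphisms of Hodge structures are strict)]
[cite: GouveaYui2011, §1 (h^{3,0} = h^{0,3} = 1, h^{2,1} = 0 for rigid Calabi–Yau threefolds)] -/
theorem stub_nonzeroHodgeHomBijective :
    ∀ ⦃X₀ X₀' : SchemeOver.{0} ℚ⦄, Rigid X₀ → Rigid X₀' →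
      ∀ Φ : complexBetti (cx X₀) 3 →ₗ[ℂ] complexBetti (cx X₀') 3,
        IsHodgeHom (cx X₀) (cx X₀') Φ → Φ ≠ 0 → Function.Bijective Φ := by
  sorry

/-- STUB 2 (THE OPEN HEART; load-bearing) — **Hodge homomorphisms between the `H³`'s of rigid-type
threefolds over `ℚ` are MOTIVATED correspondences**: `Φ = γ^*` for a motivated class
`γ ∈ A_mot³((X₀' × X₀)_ℂ)_ℂ ⊆ H⁶` (`IsMotivatedCorrespondence 3 3 (X₀')_ℂ (X₀)_ℂ Φ`; by Poincaré
duality and Künneth, `Φ` IS a rational `(3,3)`-class in `H³(X₀')⊗H³(X₀)^∨ ⊂ H⁶((X₀'×X₀)(ℂ))(3)`, and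
the stub says that class is motivated). Why plausibly true: it is André's motivated Hodge
conjecture on the `H³ ⊗ H³` sector of rigid-type pairs — implied by the route target
`RigidSectorHodge` (stmt-18577: the class is even ALGEBRAIC; `A ⊆ A_mot`) hence by HC, and the
standing expectation; the rank-2 weight-3 Hodge structure `H³(X_ℂ; ℚ) ≅ H¹(E_X; ℚ)(-1)` (`E_X` the
intermediate-Jacobian elliptic curve) is of CM/abelian TYPE abstractly, and for varieties whose
MOTIVE lies in the tensor category generated by abelian varieties André's Thm. 0.6.2 makes Hodge
classes motivated — so the stub holds for every rigid-type `X₀, X₀'` dominated by products of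
curves / of Kummer–Borcea–Voisin type (the level-27/32/49 CM examples, Schoen's fibre products),
which is where a prover should start. Why it might fail / why it is hard: for a rigid-type `X₀`
NOT known to be of abelian motivic type the isomorphism `H³(X) ≅ H¹(E_X)(-1)` is transcendental
data (the period ratio `τ_X`), and NO transcendence theory touches weight-3 periods (weight 1:
Schneider, Wüstholz; the K3 analogue is free by CM of definite rank-2 lattices) — a single
`GL₂(ℚ)`-coincidence `τ_X ≡ τ_{X'}` between NON-relative rigid-type threefolds gives a Hodge
isomorphism that is not motivated (by STUB 3 it would force relatives), i.e. a counterexample to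
HC; conversely STUB 2 + standard conjecture `B` for the sixfolds involved ⇒ `RigidSectorHodge`.
Size: open problem (the crux's real content, isolated). Leans on: `motivatedClasses`,
`IsMotivatedClass`, `corrClassAction` (MotivatedClasses); facts
`Andre1996_hodgeClasses_abelianVariety_motivated`, `Andre1996_deformation` (unproved, by name) for
the abelian-type sub-case. [cite: Andre1996Motifs, Thm. 0.6.2 (p. 9), §6.3 (p. 31), §2.1 Déf. 1]
[cite: Deligne1982HodgeCycles, §2 Ex. 2.1(a) and Thm. 2.11] [cite: GouveaYui2011, Thm. 1]
[cite: MeyerModularCY2005, Ch. 1–2 (rigid Calabi–Yau threefolds, intermediate Jacobians)] -/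
theorem stub_hodgeHomMotivated :
    ∀ ⦃X₀ X₀' : SchemeOver.{0} ℚ⦄, Rigid X₀ → Rigid X₀' →
      ∀ Φ : complexBetti (cx X₀) 3 →ₗ[ℂ] complexBetti (cx X₀') 3,
        IsHodgeHom (cx X₀) (cx X₀') Φ → IsMotivatedCorrespondence 3 3 (cx X₀') (cx X₀) Φ := by
  sorry

/-- STUB 3 (IN PRINT — André 1996 §2.5 a) Scolie and Prop. 2.5.1, Deligne 1982 Prop. 2.9; XL on
the tree) — **a bijective motivated correspondence preserving rational classes between the `H³`'s
of smooth projective threefolds over `ℚ` is Galois-compatible on an open subgroup**: if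
`Φ : H³((X₀)_ℂ; ℂ) → H³((X₀')_ℂ; ℂ)` maps rational classes to rational classes, is `γ^*` for a
motivated `γ` on `(X₀' × X₀)_ℂ`, and is bijective, then for some (indeed every) prime `ℓ` there are
an open `U ≤ Gal(ℚ̄/ℚ)` and a `ℚ_ℓ`-linear isomorphism `H³((X₀)_ℚ̄, ℚ_ℓ) ≃ H³((X₀')_ℚ̄, ℚ_ℓ)`
commuting with `U` (`GalIso`). Proof in print: (a) the `(3,3)`-Künneth component `γ₃₃` of `γ` is
again motivated (Künneth projectors are motivated, Prop. 1.2 / §4.1) and still acts as `Φ` on `H³`;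
`Φ` rational ⇒ `γ₃₃ ∈ (A_mot ⊗ ℂ) ∩ H⁶(–; ℚ) = A_mot((X₀'×X₀)_ℂ)_ℚ` (Prop. 3.3, `Q = ℚ`);
(b) §2.5 a) Scolie (p. 17): "`A_mot(X_L) = A_mot(X_{K^sép})`, et `Gal(K^sép/K)` agit sur
`A_mot(X_{K^sép})` à travers un groupe fini" with `K = ℚ`, `L = ℂ`, `X = X₀' × X₀` — so the
stabiliser `U` of `γ₃₃` is open; (c) the `ℓ`-adic cycle class / comparison is `Gal`-equivariant
([D82] 2.9, 2.7 as used loc. cit.; Prop. 2.5.1: motivated ⇒ absolute Hodge), so the `ℓ`-adic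
realisation `e = (γ₃₃)_ℓ^* : H³((X₀)_ℚ̄, ℚ_ℓ) → H³((X₀')_ℚ̄, ℚ_ℓ)` commutes with `ρ(g)`, `g ∈ U`;
(d) under Artin's comparison `H³_B(X(ℂ); ℚ) ⊗ ℚ_ℓ ≅ H³_ét(X_ℚ̄, ℚ_ℓ)` (SGA 4 XI 4.4 + invariance of
étale cohomology under `ℚ̄ ⊂ ℂ`), `e = Φ_ℚ ⊗ ℚ_ℓ`, bijective because `Φ` is. Why it might fail /
cost on the tree: mathematically a theorem; on the tree XL — there is no Artin comparison between
the real carriers `complexBetti` and `ellAdicEtaleCohomologyRat` (only the hypothesis-structure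
`ArtinComparison` of `AlgebraicClassesPotentiallyTate`), no `ℓ`-adic cycle class on
`ellAdicEtaleCohomologyRat`, and no Galois action on `motivatedClasses`; each is a Literature
programme of its own. The hypotheses are deliberately minimal (smooth projective, not rigid) so
that the stub is exactly the printed theorem. Size: XL (tree infrastructure), S in print. Leans on:
`motivatedClasses`, `corrClassAction` (MotivatedClasses); `geometricEllAdicEtaleCohomologyRepRat`,
`ellAdicEtaleCohomologyRat` (EllAdicEtaleRational); `geometricFibre` (EtaleGaloisAction).
[cite: Andre1996Motifs, §2.5 a) Scolie and Prop. 2.5.1 (pp. 17–18); Prop. 3.3; §4.1]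
[cite: Deligne1982HodgeCycles, Prop. 2.9 and 2.7] [cite: CharlesSchnell2014Notes, §11.2–11.3]
[cite: Faltings1983Endlichkeit, Satz 3–4 (the Galois side these isomorphisms feed)] -/
theorem stub_motivatedGalois :
    ∀ ⦃X₀ X₀' : SchemeOver.{0} ℚ⦄, IsSmoothProjective 3 X₀ → IsSmoothProjective 3 X₀' →
      ∀ Φ : complexBetti (cx X₀) 3 →ₗ[ℂ] complexBetti (cx X₀') 3,
        (∀ x, IsRationalClass x → IsRationalClass (Φ x)) →
          IsMotivatedCorrespondence 3 3 (cx X₀') (cx X₀) Φ → Function.Bijective Φ →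
            GalIso X₀ X₀' := by
  sorry

/-! ### The composition -/

/-- **THE LINE'S COMPOSITION** (kernel-checked, no `sorry`): if non-zero Hodge homomorphisms of
rigid-type `H³`'s are bijective (STUB 1), Hodge homomorphisms of rigid-type `H³`'s are motivated
(STUB 2), and bijective rational motivated correspondences of `H³`'s over `ℚ` are Galois-compatible
on an open subgroup (STUB 3), then `HodgeIsoForcesRelatives` — for rigid-type `X₀, X₀'` and a
non-zero Hodge hom `Φ`, STUB 2 makes `Φ` motivated, STUB 1 bijective, STUB 3 gives `GalIso`.
[cite: Deligne1982HodgeCycles, §2 (the chain Hodge ⇒ absolute Hodge ⇒ Galois)]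
[cite: Andre1996Motifs, §2.5] -/
theorem HodgeIsoForcesRelatives_of :
    (∀ ⦃X₀ X₀' : SchemeOver.{0} ℚ⦄, Rigid X₀ → Rigid X₀' →
      ∀ Φ : complexBetti (cx X₀) 3 →ₗ[ℂ] complexBetti (cx X₀') 3,
        IsHodgeHom (cx X₀) (cx X₀') Φ → Φ ≠ 0 → Function.Bijective Φ) →
    (∀ ⦃X₀ X₀' : SchemeOver.{0} ℚ⦄, Rigid X₀ → Rigid X₀' →
      ∀ Φ : complexBetti (cx X₀) 3 →ₗ[ℂ] complexBetti (cx X₀') 3,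
        IsHodgeHom (cx X₀) (cx X₀') Φ → IsMotivatedCorrespondence 3 3 (cx X₀') (cx X₀) Φ) →
    (∀ ⦃X₀ X₀' : SchemeOver.{0} ℚ⦄, IsSmoothProjective 3 X₀ → IsSmoothProjective 3 X₀' →
      ∀ Φ : complexBetti (cx X₀) 3 →ₗ[ℂ] complexBetti (cx X₀') 3,
        (∀ x, IsRationalClass x → IsRationalClass (Φ x)) →
          IsMotivatedCorrespondence 3 3 (cx X₀') (cx X₀) Φ → Function.Bijective Φ →
            GalIso X₀ X₀') →
    Summit.HodgeConjecture.HodgeConjecture.Theses.RigidRelativesJacobianTorelli.HodgeIsoForcesRelatives :=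
  fun h₁ h₂ h₃ =>
    hodgeIsoForcesRelatives_iff.2 fun _ _ hX hX' Φ hΦ hne =>
      h₃ hX.1 hX'.1 Φ hΦ.1 (h₂ hX hX' Φ hΦ) (h₁ hX hX' Φ hΦ hne)

/-- **The crux, closed modulo exactly the three registered stubs.** -/
theorem HodgeIsoForcesRelatives_of_stubs :
    Summit.HodgeConjecture.HodgeConjecture.Theses.RigidRelativesJacobianTorelli.HodgeIsoForcesRelatives :=
  HodgeIsoForcesRelatives_of stub_nonzeroHodgeHomBijective stub_hodgeHomMotivated stub_motivatedGalois

end Summit.HodgeConjecture.HodgeConjecture.Cruxes.HodgeIsoForcesRelatives.Birth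

end
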